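import Literature.Geometry.Kaehler.SiegelTorusThetaNullModular
import Literature.Geometry.Kaehler.SiegelTorusThetaNullGradient
import HarnessLib

/-!
# The strata `θ_null^h` are well defined on `𝒜_g`: the `z`-Hessian of `ϑ[ε;δ]` at a vanishing theta
# constant transforms by `ᵗ(cτ+d)` under `Sp_{2g}(ℤ)`, so the Hessian-rank strata are invariant

Layer `Literature/Geometry/Kaehler`, namespace `Literature.Geometry.Kaehler.ComplexTorus` (lane
`lit-hodgefound`, Layer A4, theta-divisor row A4-17; prover seat `lit-hodgefound-p23`, row «A4-17(r)»).
Sequel of `SiegelTorusThetaNullModular.lean` (the case of `θ_null` itself: a theta constant vanishes at `Z`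
iff the transformed one vanishes at `M(Z)`, the action `M[·]` on half-integer characteristics preserves
parity), of `SiegelTorusThetaNullRank.lean` (`MemThetaNullRank h` = GSM's `θ_null^h`) and
`SiegelTorusThetaNullGradient.lean` (`MemThetaNullRankAt k l h` = the component `θ_{[k,l]}^h`, the
`τ`-gradient form `rank (∂ᵢ∂ⱼϑ) = rank 𝒟ϑ`), and of the theta transformation formula with its full
`z`-dependence, `RiemannThetaTransformation.lean` (`exists_riemannThetaChar_transform`, Lange Prop. 3.3.2 /
Thm. 3.3.9 up to the constant).

Source followed (held text, read at the quoted chunk): S. Grushevsky, R. Salvati Manni, *Jacobians with a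
vanishing theta-null in genus 4*, Israel J. Math. 164 (2008) [held `paper:arxiv-math_0605160` p0004]:
"Under the action of `M ∈ Sp(2g,ℤ)` the theta functions transform as follows:
`θ[M(ε;δ)](M·τ, ᵗ(cτ+d)⁻¹z) = φ(ε, δ, M, τ, z) det(cτ+d)^{1/2} θ[ε;δ](τ, z)`, where
`M(ε;δ) := (d −c; −b a)(ε;δ) + (diag(cᵗd); diag(aᵗb))` taken modulo 2 […] Definition 6. […] For
`h = 0, …, g` we let `θ_null^h = {τ ∈ ℍ_g : ∃[ε,δ] even, θ[ε;δ](τ) = 0; rk ∂²θ[ε;δ](τ,z)/∂zᵢ∂zⱼ|_{z=0} ≤ h}`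
[…] By the above transformation formulae, we see that `θ_null` and `θ_null^h` are well-defined on `𝒜_g`
and not only on the level moduli spaces `𝒜_g(4,8) := ℍ_g/Γ_g(4,8)`."

The mechanism, made explicit here (Lange's form of the formula, `M = (α β; γ δ)`, `D := γZ + δ`):
`ϑ[M[c]](ᵗD⁻¹v, M(Z)) = C · e(πi ᵗv D⁻¹γ v) · ϑ[c](v, Z)` with `C ≠ 0`. The exponential factor has value
`1` and vanishing FIRST derivative at `v = 0`; hence, at a zero `ϑ[c](0, Z) = 0`, the Hessian
of the right-hand side at `0` is `C` times the Hessian of `ϑ[c](·, Z)`, while the Hessian of the left-hand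
side is `D⁻¹ · (∂ᵢ∂ⱼϑ[M[c]](·, M(Z)))(0) · ᵗD⁻¹` (chain rule for the linear substitution `ᵗD⁻¹`). So
`(∂ᵢ∂ⱼϑ[M[c]](·, M(Z)))(0) = C · D · (∂ᵢ∂ⱼϑ[c](·, Z))(0) · ᵗD` and the ranks agree.

What is here (theorems only; no definition, no named fact, net debt `0`). The Hessian matrix of a
function `f` on `ℂ^g` at `x` is written, as in `MemThetaNullRank`, verbatim as
`Matrix.of fun i j ↦ fderiv ℂ (fun z ↦ fderiv ℂ f z (Pi.single i 1)) x (Pi.single j 1)`.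

* §1 Calculus of the Hessian matrix of an entire function on `ℂ^g` (Osgood: entire ⇒ analytic, so second
  derivatives exist and are bilinear): `fderiv_fderiv_apply_eq_of_differentiable` (`∂_v(∂_u f) = D²f[v,u]`),
  **`hessian_comp_mulVec`** (`H(f ∘ A)(x) = ᵗA · H(f)(Ax) · A` for a matrix `A`),
  **`hessian_mul_of_eq_zero`** (`H(e·f)(x) = e(x) • H(f)(x)` when `f(x) = 0` and `de(x) = 0`),
  `fderiv_const_mul_cexp_dotProduct_mulVec_zero` (the first derivative of `v ↦ C e(c ᵗvSv)` at `0` vanishes).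
* §2 **`hessian_riemannThetaChar_moeb_eq_of_eq_zero`** — for `M ∈ Sp_{2g}(ℤ)`, `Z ∈ 𝔥_g` and a
  characteristic `c = (a, b)` with `ϑ[c](0, Z) = 0`: there is `C ≠ 0` with
  `(∂ᵢ∂ⱼϑ[M[c]](·, M(Z)))(0) = C • ((γZ+δ) · (∂ᵢ∂ⱼϑ[c](·, Z))(0) · ᵗ(γZ+δ))`;
  **`rank_hessian_riemannThetaChar_moeb_eq`** — the two Hessians have the same rank; half-integer forms
  `rank_hessian_riemannThetaChar_half_moeb_eq` (GSM's `M(ε;δ)`), and the `τ`-gradient form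
  **`rank_dOp_riemannThetaChar_half_moeb_eq`** (`rk 𝒟θ[M(ε;δ)](M·τ) = rk 𝒟θ[ε;δ](τ)` at a vanishing theta
  constant, via Dsc 8 `(∂ᵢ∂ⱼϑ) = 4πi 𝒟ϑ`).
* §3 **`memThetaNullRankAt_moeb_iff`** (`M(Z) ∈ θ_{[k',l']}^h ↔ Z ∈ θ_{[k,l]}^h`, with GSM's
  `k' = δk − γl + (γᵗδ)₀`, `l' = αl − βk + (αᵗβ)₀`), `MemThetaNullRankAt.moeb`, **`MemThetaNullRank.moeb`**,
  **`memThetaNullRank_moeb_iff`** (`M(Z) ∈ θ_null^h ↔ Z ∈ θ_null^h`: "`θ_null^h` [is] well-defined on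
  `𝒜_g`"), the translation case `memThetaNullRank_add_intCast_iff` (`M = (1 β; 0 1)`) and, one component
  at a time, `memThetaNullRankAt_add_intCast_iff` (`Z + β ∈ θ_{[k, l − βk + (β)₀]}^h ↔ Z ∈ θ_{[k,l]}^h`),
  `memThetaNullRankAt_diag_iff` (`αZᵗα ∈ θ_{[ᵗα⁻¹k, αl]}^h ↔ Z ∈ θ_{[k,l]}^h`, `α ∈ GL_g(ℤ)`);
  `setOf_memThetaNullRank_moeb_eq`.
* §4 VALIDATION (genus 2): the whole `Sp_4(ℤ)`-orbit of the diagonal locus `τ₁ ⊕ τ₂` lies in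
  `θ_null² ∖ θ_null¹` — `blockDiag_mem_siegelUpperHalfSpace`, `memThetaNullRank_two_moeb_blockDiag`
  (any `n₁, n₂ ≥ 1`), **`memThetaNullRank_moeb_fin_one_blockDiag_iff`** (`M(τ₁ ⊕ τ₂) ∈ θ_null^h ↔ 2 ≤ h`),
  `not_memThetaNullRank_one_moeb_fin_one_blockDiag`.

Not here: the explicit factor `φ det(cτ+d)^{1/2}` (the tree's `RiemannThetaTransformationKappa`), the
modularity of theta constants for `Γ_g(4,8)`, `θ_null^h` as a subvariety of `𝒜_g(4,8)` or `𝒜_g`.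

## References

* [GrushevskySalvatiManni2008] S. Grushevsky, R. Salvati Manni, *Jacobians with a vanishing theta-null in
  genus 4*, Israel J. Math. 164 (2008), 303–315 (arXiv:math/0605160), Definitions 5–6 and the sentence
  following Definition 6 (p0004 L122–L173 of the held text).
* [Lange2023AbelianVarietiesComplex] H. Lange, *Abelian Varieties over the Complex Numbers* (2023),
  §3.1.3 Prop. 3.1.6, §3.3.1 Lemma 3.3.1 / Prop. 3.3.2, §3.3.3 Thm. 3.3.9.
* [MumfordTata1] D. Mumford, *Tata Lectures on Theta I*, Ch. II §5 (the functional equation of `ϑ` under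
  `Sp(2g,ℤ)`).
* [HormanderSCV1973] L. Hörmander, *An Introduction to Complex Analysis in Several Variables*, Thm. 2.2.6
  (entire functions are analytic — the tree's `ThetaRigidity.analyticOnNhd_univ`).
-/

noncomputable section

open scoped Topology
open scoped Real
open Set Function Complex Matrix Filter
open Literature.Analysis.SpecialFunctions Literature.Analysis.Complex

namespace Literature.Geometry.Kaehler

namespace ComplexTorus

open Literature.NumberTheory.Automorphic (siegelUpperHalfSpace)
open Literature.NumberTheory.ModularForms.SiegelUpperHalfSpace (moeb denom)

variable {n : ℕ}

/-! ### §1 Calculus of the Hessian matrix of an entire function on `ℂ^g` -/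

section Calculus

/-- `rank (c • A) = rank A` for `c ≠ 0`. [folklore] -/
private theorem rank_smul_of_ne_zero₁ {m : Type*} [Fintype m] [DecidableEq m] {c : ℂ} (hc : c ≠ 0)
    (A : Matrix m m ℂ) : (c • A).rank = A.rank := by
  refine le_antisymm ?_ ?_
  · rw [Matrix.smul_eq_diagonal_mul]
    exact Matrix.rank_mul_le_right _ _
  · conv_lhs => rw [show A = c⁻¹ • (c • A) by rw [smul_smul, inv_mul_cancel₀ hc, one_smul]]
    rw [Matrix.smul_eq_diagonal_mul]
    exact Matrix.rank_mul_le_right _ _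

/-- An entire function on `ℂ^g` has an everywhere-differentiable derivative (Osgood: entire ⇒ analytic).
[cite: HormanderSCV1973, Thm 2.2.6] -/
theorem differentiable_fderiv_of_differentiable {f : (Fin n → ℂ) → ℂ} (hf : Differentiable ℂ f) :
    Differentiable ℂ (fderiv ℂ f) := fun x ↦
  ((ThetaRigidity.analyticOnNhd_univ hf) x (mem_univ x)).fderiv.differentiableAt

/-- `x ↦ ∂_u f(x)` is entire for an entire `f` on `ℂ^g`. [cite: HormanderSCV1973, Thm 2.2.6] -/
theorem differentiable_fderiv_apply_of_differentiable {f : (Fin n → ℂ) → ℂ} (hf : Differentiable ℂ f)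
    (u : Fin n → ℂ) : Differentiable ℂ fun z ↦ fderiv ℂ f z u :=
  (ContinuousLinearMap.apply ℂ ℂ u).differentiable.comp (differentiable_fderiv_of_differentiable hf)

/-- **Second derivatives along two vectors are values of the second Fréchet derivative**:
`∂_v (∂_u f)(x) = D²f(x)[v][u]` for an entire `f` on `ℂ^g`. [cite: HormanderSCV1973, Thm 2.2.6] -/
theorem fderiv_fderiv_apply_eq_of_differentiable {f : (Fin n → ℂ) → ℂ} (hf : Differentiable ℂ f)
    (x u v : Fin n → ℂ) :
    fderiv ℂ (fun z ↦ fderiv ℂ f z u) x v = fderiv ℂ (fderiv ℂ f) x v u := by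
  have hd : DifferentiableAt ℂ (fderiv ℂ f) x := differentiable_fderiv_of_differentiable hf x
  have h := fderiv_clm_apply hd (differentiableAt_const u)
  rw [show (fun z ↦ fderiv ℂ f z u) = fun z ↦ (fderiv ℂ f z) ((fun _ ↦ u) z) from rfl, h]
  simp [ContinuousLinearMap.flip_apply]

/-- `w ↦ A w` is differentiable (a linear map on `ℂ^g`). [folklore] -/
private theorem differentiable_mulVec₁ (A : Matrix (Fin n) (Fin n) ℂ) :
    Differentiable ℂ fun w : Fin n → ℂ ↦ A *ᵥ w := by
  have h : (fun w : Fin n → ℂ ↦ A *ᵥ w) =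
      ⇑(LinearMap.toContinuousLinearMap (Matrix.toLin' A)) := by
    funext w
    simp
  rw [h]
  exact (LinearMap.toContinuousLinearMap (Matrix.toLin' A)).differentiable

/-- **Second derivatives under a linear substitution**: for an entire `f` on `ℂ^g` and a matrix `A`,
`D²(f ∘ A)(x)[v][u] = D²f(Ax)[Av][Au]`. [cite: HormanderSCV1973, Thm 2.2.6] -/
theorem fderiv_fderiv_comp_mulVec {f : (Fin n → ℂ) → ℂ} (hf : Differentiable ℂ f)
    (A : Matrix (Fin n) (Fin n) ℂ) (x u v : Fin n → ℂ) :
    fderiv ℂ (fderiv ℂ (fun z ↦ f (A *ᵥ z))) x v u =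
      fderiv ℂ (fderiv ℂ f) (A *ᵥ x) (A *ᵥ v) (A *ᵥ u) := by
  set L : (Fin n → ℂ) →L[ℂ] (Fin n → ℂ) := LinearMap.toContinuousLinearMap (Matrix.toLin' A) with hL
  have hLapp : ∀ z, L z = A *ᵥ z := fun z ↦ by simp [hL]
  have hcomp : (fun z ↦ f (A *ᵥ z)) = f ∘ L := funext fun z ↦ by simp [hLapp]
  have hcd : ContDiff ℂ 2 f := (ThetaRigidity.analyticOnNhd_univ hf).contDiff
  have h1 : fderiv ℂ (fderiv ℂ (f ∘ L)) x v u = iteratedFDeriv ℂ 2 (f ∘ L) x ![v, u] := by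
    rw [iteratedFDeriv_two_apply]
    rfl
  have h2 : fderiv ℂ (fderiv ℂ f) (L x) (L v) (L u) = iteratedFDeriv ℂ 2 f (L x) ![L v, L u] := by
    rw [iteratedFDeriv_two_apply]
    rfl
  rw [hcomp, h1, ContinuousLinearMap.iteratedFDeriv_comp_right L hcd x le_rfl,
    ContinuousMultilinearMap.compContinuousLinearMap_apply, ← hLapp x, ← hLapp v, ← hLapp u, h2]
  congr 1
  funext k
  fin_cases k <;> rfl

/-- Expansion of a vector of `ℂ^g` in the coordinate vectors `eᵢ = Pi.single i 1`. [folklore] -/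
private theorem eq_sum_smul_single (v : Fin n → ℂ) :
    v = ∑ l, v l • (Pi.single l (1 : ℂ) : Fin n → ℂ) := by
  funext i
  simp [Finset.sum_apply, Pi.single_apply]

/-- A continuous bilinear form on `ℂ^g` in coordinates: `B(v)(u) = ∑ₗ ∑ₖ vₗ uₖ B(eₗ)(eₖ)`. [folklore] -/
private theorem clm_apply_apply_eq_sum (B : (Fin n → ℂ) →L[ℂ] (Fin n → ℂ) →L[ℂ] ℂ)
    (v u : Fin n → ℂ) :
    B v u = ∑ l, ∑ k, v l * u k * B (Pi.single l 1) (Pi.single k 1) := by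
  conv_lhs => rw [eq_sum_smul_single v, eq_sum_smul_single u]
  simp only [map_sum, map_smul, _root_.sum_apply, _root_.smul_apply, smul_eq_mul, Finset.mul_sum]
  rw [Finset.sum_comm]
  refine Finset.sum_congr rfl fun l _ ↦ Finset.sum_congr rfl fun k _ ↦ ?_
  ring

/-- The coordinates of `A eⱼ`: `(A · Pi.single j 1) l = A l j`. [folklore] -/
private theorem mulVec_single_one_apply (A : Matrix (Fin n) (Fin n) ℂ) (j l : Fin n) :
    (A *ᵥ Pi.single j (1 : ℂ)) l = A l j := by
  simp [Matrix.mulVec, dotProduct, Pi.single_apply]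

/-- **The Hessian matrix under a linear substitution**: for an entire `f` on `ℂ^g` and a `g × g`
matrix `A`, `(∂ᵢ∂ⱼ(f ∘ A))(x) = ᵗA · (∂ᵢ∂ⱼf)(Ax) · A` — the chain rule for the substitution
`z ↦ Az` applied twice (in Definition 6 the substitution is `z ↦ ᵗ(cτ+d)⁻¹z`).
[cite: GrushevskySalvatiManni2008, Definitions 5–6 (p0004 of the held text)] [cite: HormanderSCV1973, Thm 2.2.6] -/
theorem hessian_comp_mulVec {f : (Fin n → ℂ) → ℂ} (hf : Differentiable ℂ f)
    (A : Matrix (Fin n) (Fin n) ℂ) (x : Fin n → ℂ) :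
    (Matrix.of fun i j : Fin n ↦ fderiv ℂ (fun z ↦ fderiv ℂ (fun w ↦ f (A *ᵥ w)) z
        (Pi.single i (1 : ℂ))) x (Pi.single j (1 : ℂ))) =
      Aᵀ * (Matrix.of fun i j : Fin n ↦ fderiv ℂ (fun z ↦ fderiv ℂ f z (Pi.single i (1 : ℂ))) (A *ᵥ x)
        (Pi.single j (1 : ℂ))) * A := by
  have hg : Differentiable ℂ (fun w ↦ f (A *ᵥ w)) := hf.comp (differentiable_mulVec₁ A)
  ext i j
  rw [Matrix.of_apply, fderiv_fderiv_apply_eq_of_differentiable hg, fderiv_fderiv_comp_mulVec hf,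
    clm_apply_apply_eq_sum, Matrix.mul_apply]
  simp_rw [Matrix.mul_apply, Matrix.transpose_apply, Matrix.of_apply,
    fderiv_fderiv_apply_eq_of_differentiable hf, mulVec_single_one_apply, Finset.sum_mul]
  refine Finset.sum_congr rfl fun l _ ↦ Finset.sum_congr rfl fun k _ ↦ ?_
  ring

/-- **Second derivatives of a product at a common critical zero**: if `f(x) = 0` and `de(x) = 0` then
`∂_v∂_u(e·f)(x) = e(x) · ∂_v∂_u f(x)` (`e`, `f` entire on `ℂ^g`) — the two cross terms `∂e · ∂f` and the
term `f · ∂∂e` vanish. [cite: HormanderSCV1973, Thm 2.2.6] -/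
theorem fderiv_fderiv_mul_apply_of_eq_zero {e f : (Fin n → ℂ) → ℂ} (he : Differentiable ℂ e)
    (hf : Differentiable ℂ f) {x : Fin n → ℂ} (hf0 : f x = 0) (he0 : fderiv ℂ e x = 0)
    (u v : Fin n → ℂ) :
    fderiv ℂ (fun z ↦ fderiv ℂ (fun w ↦ e w * f w) z u) x v =
      e x * fderiv ℂ (fun z ↦ fderiv ℂ f z u) x v := by
  have h1 : (fun z ↦ fderiv ℂ (fun w ↦ e w * f w) z u) =
      fun z ↦ e z * fderiv ℂ f z u + f z * fderiv ℂ e z u := by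
    funext z
    rw [fderiv_fun_mul (he z) (hf z)]
    simp only [_root_.add_apply, _root_.smul_apply, smul_eq_mul]
  rw [h1]
  have hDf := (differentiable_fderiv_apply_of_differentiable hf u) x
  have hDe := (differentiable_fderiv_apply_of_differentiable he u) x
  rw [fderiv_fun_add ((he x).fun_mul hDf) ((hf x).fun_mul hDe), fderiv_fun_mul (he x) hDf,
    fderiv_fun_mul (hf x) hDe]
  simp [hf0, he0]

/-- **The Hessian matrix of a product at a common critical zero**: `(∂ᵢ∂ⱼ(e·f))(x) = e(x) • (∂ᵢ∂ⱼf)(x)`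
when `f(x) = 0` and `de(x) = 0`. [cite: HormanderSCV1973, Thm 2.2.6] -/
theorem hessian_mul_of_eq_zero {e f : (Fin n → ℂ) → ℂ} (he : Differentiable ℂ e)
    (hf : Differentiable ℂ f) {x : Fin n → ℂ} (hf0 : f x = 0) (he0 : fderiv ℂ e x = 0) :
    (Matrix.of fun i j : Fin n ↦ fderiv ℂ (fun z ↦ fderiv ℂ (fun w ↦ e w * f w) z
        (Pi.single i (1 : ℂ))) x (Pi.single j (1 : ℂ))) =
      e x • Matrix.of fun i j : Fin n ↦ fderiv ℂ (fun z ↦ fderiv ℂ f z (Pi.single i (1 : ℂ))) x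
        (Pi.single j (1 : ℂ)) := by
  ext i j
  rw [Matrix.of_apply, Matrix.smul_apply, Matrix.of_apply, smul_eq_mul,
    fderiv_fderiv_mul_apply_of_eq_zero he hf hf0 he0]

/-- The quadratic form `v ↦ ᵗv S v` has vanishing derivative at `0`. [folklore] -/
private theorem hasFDerivAt_dotProduct_mulVec_self_zero (S : Matrix (Fin n) (Fin n) ℂ) :
    HasFDerivAt (fun v : Fin n → ℂ ↦ v ⬝ᵥ (S *ᵥ v)) (0 : (Fin n → ℂ) →L[ℂ] ℂ) 0 := by
  have h : ∀ i j : Fin n,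
      HasFDerivAt (fun v : Fin n → ℂ ↦ v i * v j) (0 : (Fin n → ℂ) →L[ℂ] ℂ) 0 := by
    intro i j
    have := (hasFDerivAt_apply (𝕜 := ℂ) i (0 : Fin n → ℂ)).fun_mul
      (hasFDerivAt_apply (𝕜 := ℂ) j (0 : Fin n → ℂ))
    refine this.congr_fderiv ?_
    ext v
    simp
  have hsum : HasFDerivAt (fun v : Fin n → ℂ ↦ ∑ i, ∑ j, S i j * (v i * v j))
      (0 : (Fin n → ℂ) →L[ℂ] ℂ) 0 := by
    have := HasFDerivAt.fun_sum (u := Finset.univ) fun i _ ↦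
      HasFDerivAt.fun_sum (u := Finset.univ) fun j _ ↦ ((h i j).const_mul (S i j))
    refine this.congr_fderiv (Finset.sum_eq_zero fun i _ ↦ Finset.sum_eq_zero fun j _ ↦ ?_)
    ext v
    simp
  refine hsum.congr_of_eventuallyEq (Eventually.of_forall fun v ↦ ?_)
  simp only [dotProduct, Matrix.mulVec, Finset.mul_sum]
  exact Finset.sum_congr rfl fun i _ ↦ Finset.sum_congr rfl fun j _ ↦ by ring

/-- The quadratic form `v ↦ ᵗv S v` is differentiable. [folklore] -/
private theorem differentiable_dotProduct_mulVec_self₁ (S : Matrix (Fin n) (Fin n) ℂ) :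
    Differentiable ℂ fun v : Fin n → ℂ ↦ v ⬝ᵥ (S *ᵥ v) := by
  simp only [dotProduct, mulVec]
  fun_prop

/-- `v ↦ C · e(c ᵗv S v)` is entire. [folklore] -/
private theorem differentiable_const_mul_cexp_dotProduct_mulVec (C c : ℂ) (S : Matrix (Fin n) (Fin n) ℂ) :
    Differentiable ℂ fun v : Fin n → ℂ ↦ C * cexp (c * (v ⬝ᵥ (S *ᵥ v))) :=
  (((differentiable_dotProduct_mulVec_self₁ S).const_mul c).cexp).const_mul C

/-- **The first derivative of `v ↦ C · e(c ᵗv S v)` vanishes at `v = 0`** (the exponential factor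
`φ` of the transformation formula is critical at `z = 0`). [cite: GrushevskySalvatiManni2008, Definition 5 (p0004 of the held text)] -/
theorem fderiv_const_mul_cexp_dotProduct_mulVec_zero (C c : ℂ) (S : Matrix (Fin n) (Fin n) ℂ) :
    fderiv ℂ (fun v : Fin n → ℂ ↦ C * cexp (c * (v ⬝ᵥ (S *ᵥ v)))) 0 = 0 := by
  have h := (((hasFDerivAt_dotProduct_mulVec_self_zero S).const_mul c).cexp).const_mul C
  rw [h.fderiv]
  ext v
  simp

end Calculus

/-! ### §2 The transformation law of the `z`-Hessian of `ϑ[c]` at a vanishing theta constant -/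

section Transformation

variable {M : Matrix (Fin n ⊕ Fin n) (Fin n ⊕ Fin n) ℤ} {Z : Matrix (Fin n) (Fin n) ℂ}

/-- **The `z`-Hessian of a theta function with characteristic transforms by `ᵗ(γZ+δ)` under
`Sp_{2g}(ℤ)`, at a vanishing theta constant.** For `M = (α β; γ δ) ∈ Sp_{2g}(ℤ)`, `Z ∈ 𝔥_g` and a
characteristic `c = (a, b)` with `ϑ[c](0, Z) = 0` there is `C ≠ 0` (Lange's `C(Z, M, c)`, GSM's
`φ det(cτ+d)^{1/2}` at `z = 0`) with
`(∂ᵢ∂ⱼϑ[M[c]](·, M(Z)))(0) = C • ((γZ+δ) · (∂ᵢ∂ⱼϑ[c](·, Z))(0) · ᵗ(γZ+δ))`.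
Proof: differentiate `ϑ[M[c]](ᵗ(γZ+δ)⁻¹v, M(Z)) = C e(πi ᵗv(γZ+δ)⁻¹γv) ϑ[c](v, Z)` twice at `v = 0`;
the exponential is critical at `0` and `ϑ[c](0, Z) = 0`, so only `C · (∂ᵢ∂ⱼϑ[c](·,Z))(0)` survives on the
right, while the left-hand side gives `(γZ+δ)⁻¹ · (∂ᵢ∂ⱼϑ[M[c]](·, M(Z)))(0) · ᵗ(γZ+δ)⁻¹`.
[cite: GrushevskySalvatiManni2008, Definitions 5–6 and the sentence after Definition 6 (p0004 of the held text)]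
[cite: Lange2023AbelianVarietiesComplex, §3.3.3 Thm. 3.3.9 (p0175)] -/
theorem hessian_riemannThetaChar_moeb_eq_of_eq_zero (hM : M ∈ Matrix.symplecticGroup (Fin n) ℤ)
    (hZ : Z ∈ siegelUpperHalfSpace n) (a b : Fin n → ℂ) (h0 : riemannThetaChar a b Z 0 = 0) :
    ∃ C : ℂ, C ≠ 0 ∧
      (Matrix.of fun i j : Fin n ↦ fderiv ℂ (fun z ↦ fderiv ℂ
          (riemannThetaChar (thetaCharFst M a b) (thetaCharSnd M a b) (moeb (M.map ((↑) : ℤ → ℂ)) Z)) z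
          (Pi.single i (1 : ℂ))) 0 (Pi.single j (1 : ℂ))) =
        C • (denom (M.map ((↑) : ℤ → ℂ)) Z *
            (Matrix.of fun i j : Fin n ↦ fderiv ℂ (fun z ↦ fderiv ℂ (riemannThetaChar a b Z) z
              (Pi.single i (1 : ℂ))) 0 (Pi.single j (1 : ℂ))) *
          (denom (M.map ((↑) : ℤ → ℂ)) Z)ᵀ) := by
  -- the transformation formula (Lange Prop. 3.3.2 / Thm. 3.3.9 up to the constant)
  obtain ⟨C, hC, hCF⟩ := exists_riemannThetaChar_transform hM hZ a b
  set P : Matrix (Fin n ⊕ Fin n) (Fin n ⊕ Fin n) ℂ := M.map ((↑) : ℤ → ℂ) with hP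
  set D : Matrix (Fin n) (Fin n) ℂ := denom P Z with hD
  set F : (Fin n → ℂ) → ℂ :=
    riemannThetaChar (thetaCharFst M a b) (thetaCharSnd M a b) (moeb P Z) with hF
  set G : (Fin n → ℂ) → ℂ := riemannThetaChar a b Z with hG
  set HF : Matrix (Fin n) (Fin n) ℂ := Matrix.of fun i j : Fin n ↦ fderiv ℂ (fun z ↦ fderiv ℂ F z
    (Pi.single i (1 : ℂ))) 0 (Pi.single j (1 : ℂ)) with hHF
  set HG : Matrix (Fin n) (Fin n) ℂ := Matrix.of fun i j : Fin n ↦ fderiv ℂ (fun z ↦ fderiv ℂ G z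
    (Pi.single i (1 : ℂ))) 0 (Pi.single j (1 : ℂ)) with hHG
  -- differentiability data
  have hZ' := moeb_intCast_mem hM hZ
  obtain ⟨c', hc', hY'⟩ := exists_pos_mul_sum_sq_le_of_posDef_im _ hZ'.2
  have hFd : Differentiable ℂ F :=
    differentiable_riemannThetaChar _ (fun i j ↦ (hZ'.1.apply i j).symm) hc' hY' _ _
  obtain ⟨c, hc, hY⟩ := exists_pos_mul_sum_sq_le_of_posDef_im Z hZ.2
  have hGd : Differentiable ℂ G :=
    differentiable_riemannThetaChar Z (fun i j ↦ (hZ.1.apply i j).symm) hc hY a b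
  have hDu : IsUnit D.det := isUnit_det_denom_intCast hM hZ
  -- the multiplier `e(v) = C · e(πi ᵗv D⁻¹γ v)`: value `C` and derivative `0` at `v = 0`
  set e : (Fin n → ℂ) → ℂ := fun v ↦ C * cexp (π * I * (v ⬝ᵥ ((D⁻¹ * P.toBlocks₂₁) *ᵥ v))) with he
  have hed : Differentiable ℂ e := differentiable_const_mul_cexp_dotProduct_mulVec C (π * I) _
  have he0 : fderiv ℂ e 0 = 0 := fderiv_const_mul_cexp_dotProduct_mulVec_zero C (π * I) _
  have hex : e 0 = C := by simp [he]
  -- the formula as an identity of functions of `v`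
  have hfun : (fun v ↦ F (Dᵀ⁻¹ *ᵥ v)) = fun v ↦ e v * G v := by
    funext v
    rw [hCF v]
  -- Hessians of both sides at `0`
  have h1 := hessian_comp_mulVec hFd Dᵀ⁻¹ 0
  rw [hfun, Matrix.mulVec_zero, hessian_mul_of_eq_zero hed hGd h0 he0, hex] at h1
  -- `h1 : C • HG = (Dᵀ⁻¹)ᵀ * HF * Dᵀ⁻¹`; solve for `HF`
  refine ⟨C, hC, ?_⟩
  have h2 : D * (C • HG) * Dᵀ = HF := by
    rw [h1, ← Matrix.transpose_nonsing_inv, Matrix.transpose_transpose]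
    calc D * (D⁻¹ * HF * D⁻¹ᵀ) * Dᵀ = (D * D⁻¹) * HF * (D⁻¹ᵀ * Dᵀ) := by
          simp only [Matrix.mul_assoc]
      _ = HF := by
          rw [Matrix.mul_nonsing_inv _ hDu, ← Matrix.transpose_mul, Matrix.mul_nonsing_inv _ hDu,
            Matrix.transpose_one, Matrix.one_mul, Matrix.mul_one]
  rw [← h2, Matrix.mul_smul, Matrix.smul_mul]

/-- **The rank of the `z`-Hessian at a vanishing theta constant is `Sp_{2g}(ℤ)`-invariant**:
`rank (∂ᵢ∂ⱼϑ[M[c]](·, M(Z)))(0) = rank (∂ᵢ∂ⱼϑ[c](·, Z))(0)` when `ϑ[c](0, Z) = 0` ("the rank of the tangent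
cone to the theta divisor at the corresponding point of order two" does not depend on the symplectic
basis). [cite: GrushevskySalvatiManni2008, Definition 6 and the sentence after it (p0004 of the held text)] -/
theorem rank_hessian_riemannThetaChar_moeb_eq (hM : M ∈ Matrix.symplecticGroup (Fin n) ℤ)
    (hZ : Z ∈ siegelUpperHalfSpace n) (a b : Fin n → ℂ) (h0 : riemannThetaChar a b Z 0 = 0) :
    (Matrix.of fun i j : Fin n ↦ fderiv ℂ (fun z ↦ fderiv ℂ
        (riemannThetaChar (thetaCharFst M a b) (thetaCharSnd M a b) (moeb (M.map ((↑) : ℤ → ℂ)) Z)) z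
        (Pi.single i (1 : ℂ))) 0 (Pi.single j (1 : ℂ))).rank =
      (Matrix.of fun i j : Fin n ↦ fderiv ℂ (fun z ↦ fderiv ℂ (riemannThetaChar a b Z) z
        (Pi.single i (1 : ℂ))) 0 (Pi.single j (1 : ℂ))).rank := by
  obtain ⟨C, hC, h⟩ := hessian_riemannThetaChar_moeb_eq_of_eq_zero hM hZ a b h0
  have hDu := isUnit_det_denom_intCast hM hZ
  have hDt : IsUnit (denom (M.map ((↑) : ℤ → ℂ)) Z)ᵀ.det := by rwa [Matrix.det_transpose]
  rw [h, rank_smul_of_ne_zero₁ hC, Matrix.rank_mul_eq_left_of_isUnit_det _ _ hDt,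
    Matrix.rank_mul_eq_right_of_isUnit_det _ _ hDu]

/-- **Half-integer characteristics** (GSM's `M(ε;δ) = (d −c; −b a)(ε;δ) + (diag(cᵗd); diag(aᵗb))`): with
`k' = δk − γl + (γᵗδ)₀`, `l' = αl − βk + (αᵗβ)₀`,
`rank (∂ᵢ∂ⱼϑ[k'/2; l'/2](·, M(Z)))(0) = rank (∂ᵢ∂ⱼϑ[k/2; l/2](·, Z))(0)` when `ϑ[k/2; l/2](0, Z) = 0`.
[cite: GrushevskySalvatiManni2008, Definitions 5–6 (p0004 of the held text)] -/
theorem rank_hessian_riemannThetaChar_half_moeb_eq (hM : M ∈ Matrix.symplecticGroup (Fin n) ℤ)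
    (hZ : Z ∈ siegelUpperHalfSpace n) (k l : Fin n → ℤ)
    (h0 : riemannThetaChar (fun i ↦ (k i : ℂ) / 2) (fun i ↦ (l i : ℂ) / 2) Z 0 = 0) :
    (Matrix.of fun i j : Fin n ↦ fderiv ℂ (fun z ↦ fderiv ℂ
        (riemannThetaChar
          (fun i ↦ (((M.toBlocks₂₂ *ᵥ k - M.toBlocks₂₁ *ᵥ l +
            Matrix.diag (M.toBlocks₂₁ * M.toBlocks₂₂ᵀ)) i : ℤ) : ℂ) / 2)
          (fun i ↦ (((M.toBlocks₁₁ *ᵥ l - M.toBlocks₁₂ *ᵥ k +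
            Matrix.diag (M.toBlocks₁₁ * M.toBlocks₁₂ᵀ)) i : ℤ) : ℂ) / 2)
          (moeb (M.map ((↑) : ℤ → ℂ)) Z)) z
        (Pi.single i (1 : ℂ))) 0 (Pi.single j (1 : ℂ))).rank =
      (Matrix.of fun i j : Fin n ↦ fderiv ℂ (fun z ↦ fderiv ℂ
        (riemannThetaChar (fun i ↦ (k i : ℂ) / 2) (fun i ↦ (l i : ℂ) / 2) Z) z
        (Pi.single i (1 : ℂ))) 0 (Pi.single j (1 : ℂ))).rank := by
  rw [← thetaCharFst_half, ← thetaCharSnd_half]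
  exact rank_hessian_riemannThetaChar_moeb_eq hM hZ _ _ h0

/-- **The `τ`-gradient form** (GSM §2: `θ_null^h = {∃[ε,δ] even; 0 = θ[ε,δ](τ); rk 𝒟θ[ε,δ](τ) ≤ h}`):
at a vanishing theta constant, `rk 𝒟θ[M(ε;δ)](M·τ) = rk 𝒟θ[ε;δ](τ)` — by Dsc 8
(`(∂ᵢ∂ⱼϑ) = 4πi · 𝒟ϑ`, `rank_hessian_riemannThetaChar_eq_rank_dOp`) and the Hessian law.
[cite: GrushevskySalvatiManni2008, §2 (p0006) and Dsc 8 (p0005 of the held text)]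
[cite: GrushevskySalvatiManni2008, Definitions 5–6 (p0004 of the held text)] -/
theorem rank_dOp_riemannThetaChar_half_moeb_eq (hM : M ∈ Matrix.symplecticGroup (Fin n) ℤ)
    (hZ : Z ∈ siegelUpperHalfSpace n) (k l : Fin n → ℤ)
    (h0 : riemannThetaChar (fun i ↦ (k i : ℂ) / 2) (fun i ↦ (l i : ℂ) / 2) Z 0 = 0) :
    (dOp (fun Ω' ↦ riemannThetaChar
          (fun i ↦ (((M.toBlocks₂₂ *ᵥ k - M.toBlocks₂₁ *ᵥ l +
            Matrix.diag (M.toBlocks₂₁ * M.toBlocks₂₂ᵀ)) i : ℤ) : ℂ) / 2)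
          (fun i ↦ (((M.toBlocks₁₁ *ᵥ l - M.toBlocks₁₂ *ᵥ k +
            Matrix.diag (M.toBlocks₁₁ * M.toBlocks₁₂ᵀ)) i : ℤ) : ℂ) / 2) Ω' 0)
        (moeb (M.map ((↑) : ℤ → ℂ)) Z)).rank =
      (dOp (fun Ω' ↦ riemannThetaChar (fun i ↦ (k i : ℂ) / 2) (fun i ↦ (l i : ℂ) / 2) Ω' 0) Z).rank := by
  rw [← rank_hessian_riemannThetaChar_eq_rank_dOp_of_mem_siegelUpperHalfSpace (moeb_intCast_mem hM hZ),
    ← rank_hessian_riemannThetaChar_eq_rank_dOp_of_mem_siegelUpperHalfSpace hZ]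
  exact rank_hessian_riemannThetaChar_half_moeb_eq hM hZ k l h0

end Transformation

/-! ### §3 The strata `θ_null^h` and their components `θ_{[k,l]}^h` are `Sp_{2g}(ℤ)`-invariant -/

section Strata

variable {M : Matrix (Fin n ⊕ Fin n) (Fin n ⊕ Fin n) ℤ} {Z : Matrix (Fin n) (Fin n) ℂ}

/-- **`M(Z) ∈ θ_{[k',l']}^h ↔ Z ∈ θ_{[k,l]}^h`** for `M ∈ Sp_{2g}(ℤ)`, `Z ∈ 𝔥_g`, with GSM's transformed
characteristic `k' = δk − γl + (γᵗδ)₀`, `l' = αl − βk + (αᵗβ)₀`: the theta constant vanishes at `Z` iff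
the transformed one vanishes at `M(Z)`, and then the two `z`-Hessians have equal rank.
[cite: GrushevskySalvatiManni2008, Definition 6 and the sentence after it (p0004); §2 (p0006 of the held text)] -/
theorem memThetaNullRankAt_moeb_iff (hM : M ∈ Matrix.symplecticGroup (Fin n) ℤ)
    (hZ : Z ∈ siegelUpperHalfSpace n) (k l : Fin n → ℤ) (h : ℕ) :
    MemThetaNullRankAt
        (M.toBlocks₂₂ *ᵥ k - M.toBlocks₂₁ *ᵥ l + Matrix.diag (M.toBlocks₂₁ * M.toBlocks₂₂ᵀ))
        (M.toBlocks₁₁ *ᵥ l - M.toBlocks₁₂ *ᵥ k + Matrix.diag (M.toBlocks₁₁ * M.toBlocks₁₂ᵀ)) h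
        (moeb (M.map ((↑) : ℤ → ℂ)) Z) ↔
      MemThetaNullRankAt k l h Z := by
  rw [memThetaNullRankAt_iff, memThetaNullRankAt_iff, riemannThetaChar_half_zero_moeb_eq_zero_iff hM hZ]
  refine and_congr_right fun h0 ↦ ?_
  rw [rank_hessian_riemannThetaChar_half_moeb_eq hM hZ k l h0]

/-- `Z ∈ θ_{[k,l]}^h ⟹ M(Z) ∈ θ_{[k',l']}^h`. [cite: GrushevskySalvatiManni2008, Definition 6 and the sentence after it (p0004 of the held text)] -/
theorem MemThetaNullRankAt.moeb (hM : M ∈ Matrix.symplecticGroup (Fin n) ℤ)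
    (hZ : Z ∈ siegelUpperHalfSpace n) {k l : Fin n → ℤ} {h : ℕ} (hm : MemThetaNullRankAt k l h Z) :
    MemThetaNullRankAt
        (M.toBlocks₂₂ *ᵥ k - M.toBlocks₂₁ *ᵥ l + Matrix.diag (M.toBlocks₂₁ * M.toBlocks₂₂ᵀ))
        (M.toBlocks₁₁ *ᵥ l - M.toBlocks₁₂ *ᵥ k + Matrix.diag (M.toBlocks₁₁ * M.toBlocks₁₂ᵀ)) h
        (moeb (M.map ((↑) : ℤ → ℂ)) Z) :=
  (memThetaNullRankAt_moeb_iff hM hZ k l h).2 hm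

/-- **`Z ∈ θ_null^h ⟹ M(Z) ∈ θ_null^h`** for `M ∈ Sp_{2g}(ℤ)`, `Z ∈ 𝔥_g`: an even characteristic with
vanishing theta constant and Hessian of rank `≤ h` at `Z` is transported to the even characteristic
`M[·]` with the same data at `M(Z)` (parity: `even_dotProduct_symplecticChar_iff`).
[cite: GrushevskySalvatiManni2008, Definition 6 and the sentence after it (p0004 of the held text)] -/
theorem MemThetaNullRank.moeb (hM : M ∈ Matrix.symplecticGroup (Fin n) ℤ)
    (hZ : Z ∈ siegelUpperHalfSpace n) {h : ℕ} (hm : MemThetaNullRank h Z) :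
    MemThetaNullRank h (moeb (M.map ((↑) : ℤ → ℂ)) Z) := by
  rw [memThetaNullRank_iff_exists_memThetaNullRankAt] at hm ⊢
  obtain ⟨k, l, heven, hm⟩ := hm
  exact ⟨_, _, (even_dotProduct_symplecticChar_iff hM k l).2 heven, hm.moeb hM hZ⟩

/-- **`θ_null^h` is well-defined on `𝒜_g = Sp_{2g}(ℤ)\𝔥_g`: `M(Z) ∈ θ_null^h ↔ Z ∈ θ_null^h`** for
`M ∈ Sp_{2g}(ℤ)`, `Z ∈ 𝔥_g`, `h ∈ ℕ` ("By the above transformation formulae, we see that `θ_null` and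
`θ_null^h` are well-defined on `𝒜_g` and not only on the level moduli spaces `𝒜_g(4,8)`").
[cite: GrushevskySalvatiManni2008, Definition 6 and the sentence after it (p0004 of the held text)] -/
theorem memThetaNullRank_moeb_iff (hM : M ∈ Matrix.symplecticGroup (Fin n) ℤ)
    (hZ : Z ∈ siegelUpperHalfSpace n) (h : ℕ) :
    MemThetaNullRank h (moeb (M.map ((↑) : ℤ → ℂ)) Z) ↔ MemThetaNullRank h Z := by
  refine ⟨fun hm ↦ ?_, fun hm ↦ hm.moeb hM hZ⟩
  have h' := hm.moeb (((⟨M, hM⟩ : Matrix.symplecticGroup (Fin n) ℤ)⁻¹).2) (moeb_intCast_mem hM hZ)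
  rwa [moeb_symplecticInv_moeb hM hZ] at h'

/-- **The translations `Z ↦ Z + β` (`β` integral symmetric) preserve every stratum `θ_null^h`** — the
case `M = (1 β; 0 1)` (here `γZ + δ = 1`: the Hessian itself is unchanged up to the constant).
[cite: GrushevskySalvatiManni2008, Definition 6 and the sentence after it (p0004 of the held text)]
[cite: Lange2023AbelianVarietiesComplex, §3.3.4 Exercise (7)(c)] -/
theorem memThetaNullRank_add_intCast_iff {β : Matrix (Fin n) (Fin n) ℤ} (hβ : β.IsSymm)
    (hZ : Z ∈ siegelUpperHalfSpace n) (h : ℕ) :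
    MemThetaNullRank h (Z + β.map ((↑) : ℤ → ℂ)) ↔ MemThetaNullRank h Z := by
  rw [← moeb_translation β Z]
  exact memThetaNullRank_moeb_iff (fromBlocks_one_symm_mem_symplecticGroup hβ) hZ h

/-- **Translations, one component at a time**: `Z + β ∈ θ_{[k, l − βk + (β)₀]}^h ↔ Z ∈ θ_{[k,l]}^h` for
`β` integral symmetric (`M = (1 β; 0 1)`: `M(ε;δ) = (ε; δ − βε + diag β)`).
[cite: GrushevskySalvatiManni2008, Definitions 5–6 (p0004 of the held text)]
[cite: Lange2023AbelianVarietiesComplex, §3.3.1 Lemma 3.3.1 (b) (p0170); §3.3.4 Exercise (7)(c)] -/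
theorem memThetaNullRankAt_add_intCast_iff {β : Matrix (Fin n) (Fin n) ℤ} (hβ : β.IsSymm)
    (hZ : Z ∈ siegelUpperHalfSpace n) (k l : Fin n → ℤ) (h : ℕ) :
    MemThetaNullRankAt k (l - β *ᵥ k + Matrix.diag β) h (Z + β.map ((↑) : ℤ → ℂ)) ↔
      MemThetaNullRankAt k l h Z := by
  have key := memThetaNullRankAt_moeb_iff (fromBlocks_one_symm_mem_symplecticGroup hβ) hZ k l h
  simp only [Matrix.toBlocks_fromBlocks₁₁, Matrix.toBlocks_fromBlocks₁₂, Matrix.toBlocks_fromBlocks₂₁,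
    Matrix.toBlocks_fromBlocks₂₂, Matrix.one_mulVec, Matrix.zero_mulVec, sub_zero, Matrix.zero_mul,
    Matrix.diag_zero, add_zero, Matrix.one_mul, Matrix.diag_transpose, moeb_translation] at key
  exact key

/-- **Integral changes of basis `(α 0; 0 ᵗα⁻¹)`, `α ∈ GL_g(ℤ)`, one component at a time**:
`αZᵗα ∈ θ_{[ᵗα⁻¹k, αl]}^h ↔ Z ∈ θ_{[k,l]}^h` (`ᵗαδ = 1`; here `γZ + δ = δ` and the Hessian is congruent by
`δ`). [cite: GrushevskySalvatiManni2008, Definitions 5–6 (p0004 of the held text)]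
[cite: Lange2023AbelianVarietiesComplex, §3.3.1 Lemma 3.3.1 (b) (p0170); §3.3.4 Exercise (7)(b),(c)] -/
theorem memThetaNullRankAt_diag_iff {α δ : Matrix (Fin n) (Fin n) ℤ} (hαδ : αᵀ * δ = 1)
    (hZ : Z ∈ siegelUpperHalfSpace n) (k l : Fin n → ℤ) (h : ℕ) :
    MemThetaNullRankAt (δ *ᵥ k) (α *ᵥ l) h
        (α.map ((↑) : ℤ → ℂ) * Z * (α.map ((↑) : ℤ → ℂ))ᵀ) ↔ MemThetaNullRankAt k l h Z := by
  have key := memThetaNullRankAt_moeb_iff (fromBlocks_diag_mem_symplecticGroup hαδ) hZ k l h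
  -- `δ⁻¹ = ᵗα` over `ℂ`
  have hmap : (αᵀ * δ).map ((↑) : ℤ → ℂ) = αᵀ.map ((↑) : ℤ → ℂ) * δ.map ((↑) : ℤ → ℂ) :=
    Matrix.map_mul (f := Int.castRingHom ℂ)
  rw [hαδ, Matrix.map_one _ Int.cast_zero Int.cast_one, Matrix.transpose_map] at hmap
  have hinv : (δ.map ((↑) : ℤ → ℂ))⁻¹ = (α.map ((↑) : ℤ → ℂ))ᵀ := Matrix.inv_eq_left_inv hmap.symm
  simp only [Matrix.toBlocks_fromBlocks₁₁, Matrix.toBlocks_fromBlocks₁₂, Matrix.toBlocks_fromBlocks₂₁,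
    Matrix.toBlocks_fromBlocks₂₂, Matrix.zero_mulVec, sub_zero, Matrix.zero_mul, Matrix.transpose_zero,
    Matrix.mul_zero, Matrix.diag_zero, add_zero, (denom_moeb_diag α δ Z).2, hinv] at key
  exact key

/-- The strata on `𝔥_g` as sets are `Sp_{2g}(ℤ)`-stable: the preimage of
`{Z ∈ 𝔥_g ∣ Z ∈ θ_null^h}` under `Z ↦ M(Z)` meets `𝔥_g` in the same set.
[cite: GrushevskySalvatiManni2008, Definition 6 and the sentence after it (p0004 of the held text)] -/
theorem setOf_memThetaNullRank_moeb_eq (hM : M ∈ Matrix.symplecticGroup (Fin n) ℤ) (h : ℕ) :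
    {Z ∈ siegelUpperHalfSpace n | MemThetaNullRank h (moeb (M.map ((↑) : ℤ → ℂ)) Z)} =
      {Z ∈ siegelUpperHalfSpace n | MemThetaNullRank h Z} := by
  ext Z
  simp only [mem_setOf_eq]
  exact ⟨fun ⟨hZ, hm⟩ ↦ ⟨hZ, (memThetaNullRank_moeb_iff hM hZ h).1 hm⟩,
    fun ⟨hZ, hm⟩ ↦ ⟨hZ, (memThetaNullRank_moeb_iff hM hZ h).2 hm⟩⟩

end Strata

/-! ### §4 Validation (genus 2): the `Sp_4(ℤ)`-orbit of the diagonal locus lies in `θ_null² ∖ θ_null¹` -/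

section BlockDiag

variable {n₁ n₂ : ℕ} (Ω₁ : Matrix (Fin n₁) (Fin n₁) ℂ) (Ω₂ : Matrix (Fin n₂) (Fin n₂) ℂ)
  {Ω : Matrix (Fin (n₁ + n₂)) (Fin (n₁ + n₂)) ℂ}
  (hΩb : Ω = Matrix.reindex finSumFinEquiv finSumFinEquiv (Matrix.fromBlocks Ω₁ 0 0 Ω₂))
  (hΩ₁ : ∀ i j, Ω₁ i j = Ω₁ j i) (hpos₁ : (Matrix.of fun i j => (Ω₁ i j).im).PosDef)
  (hΩ₂ : ∀ i j, Ω₂ i j = Ω₂ j i) (hpos₂ : (Matrix.of fun i j => (Ω₂ i j).im).PosDef)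

include hΩb hΩ₁ hΩ₂ hpos₁ hpos₂ in
/-- **The decomposable period matrix `Ω₁ ⊕ Ω₂` lies in `𝔥_{n₁+n₂}`** (symmetric, `Im ≻ 0`).
[cite: GrushevskyXie2025, Remark 6.2 (p0034)] [cite: Lange2023AbelianVarietiesComplex, §3.1.1] -/
theorem blockDiag_mem_siegelUpperHalfSpace : Ω ∈ siegelUpperHalfSpace (n₁ + n₂) := by
  refine ⟨Matrix.IsSymm.ext fun i j ↦ ?_, ?_⟩
  · rw [hΩb]
    exact blockDiag_symm Ω₁ Ω₂ hΩ₁ hΩ₂ j i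
  · rw [hΩb]
    exact posDef_im_blockDiag Ω₁ Ω₂ hpos₁ hpos₂

include hΩb hΩ₁ hΩ₂ hpos₁ hpos₂ in
/-- **Every ppav in the `Sp_{2g}(ℤ)`-orbit of a decomposable period matrix lies in `θ_null²`**:
`M(Ω₁ ⊕ Ω₂) ∈ θ_null²` for `Ωᵢ ∈ ℌ_{nᵢ}`, `n₁, n₂ ≥ 1`, `M ∈ Sp_{2(n₁+n₂)}(ℤ)` ("ppavs with reducible
theta divisor are in `θ_null²`" is a statement on `𝒜_g`).
[cite: GrushevskySalvatiManni2008, p0007 of the held text; Definition 6 and the sentence after it (p0004)] -/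
theorem memThetaNullRank_two_moeb_blockDiag {M : Matrix (Fin (n₁ + n₂) ⊕ Fin (n₁ + n₂))
      (Fin (n₁ + n₂) ⊕ Fin (n₁ + n₂)) ℤ} (hM : M ∈ Matrix.symplecticGroup (Fin (n₁ + n₂)) ℤ)
    (hn₁ : 0 < n₁) (hn₂ : 0 < n₂) :
    MemThetaNullRank 2 (moeb (M.map ((↑) : ℤ → ℂ)) Ω) :=
  (memThetaNullRank_two_blockDiag Ω₁ Ω₂ hΩb hΩ₁ hpos₁ hΩ₂ hpos₂ hn₁ hn₂).moeb hM
    (blockDiag_mem_siegelUpperHalfSpace Ω₁ Ω₂ hΩb hΩ₁ hpos₁ hΩ₂ hpos₂)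

end BlockDiag

section GenusTwo

variable (Ω₁ : Matrix (Fin 1) (Fin 1) ℂ) (Ω₂ : Matrix (Fin 1) (Fin 1) ℂ)
  {Ω : Matrix (Fin (1 + 1)) (Fin (1 + 1)) ℂ}
  (hΩb : Ω = Matrix.reindex finSumFinEquiv finSumFinEquiv (Matrix.fromBlocks Ω₁ 0 0 Ω₂))
  (hΩ₁ : ∀ i j, Ω₁ i j = Ω₁ j i) (hpos₁ : (Matrix.of fun i j => (Ω₁ i j).im).PosDef)
  (hΩ₂ : ∀ i j, Ω₂ i j = Ω₂ j i) (hpos₂ : (Matrix.of fun i j => (Ω₂ i j).im).PosDef)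
  {M : Matrix (Fin (1 + 1) ⊕ Fin (1 + 1)) (Fin (1 + 1) ⊕ Fin (1 + 1)) ℤ}

include hΩb hΩ₁ hΩ₂ hpos₁ hpos₂ in
/-- **VALIDATION (genus 2): `M(τ₁ ⊕ τ₂) ∈ θ_null^h ↔ 2 ≤ h` for every `M ∈ Sp_4(ℤ)`** — the double point
of the theta divisor of a product of two elliptic curves is ordinary (`τ₁ ⊕ τ₂ ∈ θ_null² ∖ θ_null¹`,
`memThetaNullRank_fin_one_blockDiag_iff`), and this is a property of the point of `𝒜₂`, i.e. of the whole
`Sp_4(ℤ)`-orbit. [cite: GrushevskySalvatiManni2008, Definition 6 and the sentence after it (p0004 of the held text)]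
[cite: Grushevsky2012SchottkyProblem, §5 Thm 5.6 (held p0011)] -/
theorem memThetaNullRank_moeb_fin_one_blockDiag_iff (hM : M ∈ Matrix.symplecticGroup (Fin (1 + 1)) ℤ)
    (h : ℕ) : MemThetaNullRank h (moeb (M.map ((↑) : ℤ → ℂ)) Ω) ↔ 2 ≤ h := by
  rw [memThetaNullRank_moeb_iff hM (blockDiag_mem_siegelUpperHalfSpace Ω₁ Ω₂ hΩb hΩ₁ hpos₁ hΩ₂ hpos₂) h,
    memThetaNullRank_fin_one_blockDiag_iff Ω₁ Ω₂ hΩb hΩ₁ hpos₁ hΩ₂ hpos₂]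

include hΩb hΩ₁ hΩ₂ hpos₁ hpos₂ in
/-- **No point of the `Sp_4(ℤ)`-orbit of `τ₁ ⊕ τ₂` lies in `θ_null¹`.**
[cite: GrushevskySalvatiManni2008, Definition 6 and the sentence after it (p0004 of the held text)]
[cite: Grushevsky2012SchottkyProblem, §5 Thm 5.6 (held p0011)] -/
theorem not_memThetaNullRank_one_moeb_fin_one_blockDiag
    (hM : M ∈ Matrix.symplecticGroup (Fin (1 + 1)) ℤ) :
    ¬ MemThetaNullRank 1 (moeb (M.map ((↑) : ℤ → ℂ)) Ω) := by
  rw [memThetaNullRank_moeb_fin_one_blockDiag_iff Ω₁ Ω₂ hΩb hΩ₁ hpos₁ hΩ₂ hpos₂ hM]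
  omega

end GenusTwo

end ComplexTorus

end Literature.Geometry.Kaehler

end
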